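import Literature.MathematicalPhysics.QuantumFieldTheory.BalabanImbrieJaffe1984to88.BIJ88Ineq5144EndChainCT
import Literature.MathematicalPhysics.QuantumFieldTheory.BalabanImbrieJaffe1984to88.BIJ88WalkKernelDecay307
import Literature.MathematicalPhysics.QuantumFieldTheory.BalabanImbrieJaffe1984to88.BIJ88TruncationConnected5133
import Literature.MathematicalPhysics.QuantumFieldTheory.BalabanImbrieJaffe1984to88.BIJ88PolymerRep5134Gauss

/-!
# `BalabanImbrieJaffe1984to88.BIJ88WalkKernelCrude309` — T. Bałaban, J. Imbrie, A. Jaffe, *Effective action and cluster properties of the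
abelian Higgs model*, Commun. Math. Phys. **114** (1988) 257–315 [BalabanImbrieJaffe1988], Sect. 5.13 p. 305–307 [PDF 49–51] (p. 306 (5.13.3):
the walk kernels `C_s𝔫_s(c)` of the random walk expansion; p. 305: *"an exponentially decaying covariance C_s = (−Δ_s)⁻¹"*; p. 307 L14–16:
*"If the walk ω(α) wanders through more than a few cubes, we begin to pickup factors e^{−cr(e_k)}"*) — **THE WALK-KERNEL CERTIFICATES OF THE
MASTER BOUND FROM `Δ`-LETTERS, WITHOUT DECAY**: for the restricted interpolated precisions `(Δ_{1_Λ})_s↾X″` of the lineage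
(`BIJ88PolymerRep5134Gauss.prec`) and the boundary matrices `N_b = M_b(s) + M_b(s)ᵀ` of the block vertices (`BIJ88TruncationConnected5133.bmat`),
every entry of `C_s𝔫_s(c)` (`BIJ88TrainPieces306.wker`) is at most `(2/m)·((2/m)·n·(2nh)·2^{|I|})^{|c|}` UNIFORMLY in `s ∈ [0,1]^I`, where
`Δ ≥ m·1`, `|Δ_{xy}| ≤ h`, `n` = the number of sites of `X″` — Combes–Thomas at rate `0` for the entries of the inverse
(`BIJ88Ineq5144EndChainCT.restricted_inv_decay`) and the supersolution bound of the walk recursion with trivial gauges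
(`BIJ88WalkKernelDecay307.abs_C_mul_wker_apply_le_geometric_entry`).  This discharges the hypothesis `hκ` (`κ_c ≤ K₁`) of
`BIJ88LocatedActivityBound309.abs_actIn_le_master` / `BIJ88Ineq5144BoundedSize309` from `Δ`-letters (no smallness claimed: a SIZE, not a decay).
* §1 `abs_pairMat_le`, `sum_sum_abs_pairMat_le`, `abs_bmat_apply_le` (`|M_B(s)_{xy}| ≤ |Δ_{xy}|`), `sum_abs_bmat_add_transpose_le` (row sums of `N_b`);
* §2 `abs_prec_inv_apply_le` (`|C_s(x,l)| ≤ 2/m`), `abs_prec_inv_mul_wker_apply_le` (the certificate).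

statement-level skeleton of published theorems with citation tags; proofs where landed; nothing here is a claim about the Yang–Mills mass gap

PDF held: `paper:balaban1988-cmp114-bij-abelian-higgs-effective-action` (journal page = PDF page + 256); pages re-read this session as text:
PDF 49–51 (p. 305–307).

CITATION HEADER (lean-in-tree rule).  Part of the lit-balaban TYPED SKELETON (HOME `run/shared/lean/pub/lit-balaban/`), Phase 2, seat p36
(gen 22, unit `lit-balaban-p36`); row **C2.Eq5.14.3-5.14.4** (member: discharge of the kernel letter of the bounded-size instance; input of its
non-vacuity certificate) and C2.Eq5.13.3-5.13.4 (member) of `HOME/lit-balaban-r16/ROWS-C2-part2.md` (owner r16, referee ref-5).  Theorem-only; no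
definitions, no `Prop` facts; axioms standard.  HONEST SCOPE: sizes only (rate-`0` Combes–Thomas, unit gauges); print's per-cube decay of the walk
kernels is NOT here.  NOT summit progress; NOT continuum; NOT Clay.
-/

namespace Literature.MathematicalPhysics.QuantumFieldTheory.BalabanImbrieJaffe1984to88.BIJ88WalkKernelCrude309

open Finset Matrix
open scoped BigOperators
open Literature.MathematicalPhysics.QuantumFieldTheory.Balaban1983to89.B2Eq228Conditioning (In blkIn)
open BIJ88DirichletForms305 (interpForm)
open BIJ88TrainPieces306 (wker wker_empty)
open BIJ88TruncationConnected5133 (bmat)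
open BIJ88WalkFormOrderOne5133 (pairMat)
open BIJ88PolymerRep5134 (corner)
open BIJ88PolymerRep5134Gauss (prec)
open BIJ88PolymerRep5134GaussWitness (corner_mem_cube)
open BIJ88WalkKernelDecay307 (abs_C_mul_wker_apply_le_geometric_entry)
open BIJ88Ineq5144EndChainCT (restricted_inv_decay)

variable {α I : Type} [Fintype α] [DecidableEq α] [Fintype I] [DecidableEq I] (blk : α → I)

/-! ## §1  The entries of the vertex matrices -/

omit [Fintype α] [DecidableEq α] [Fintype I] in
/-- `|M^{il}_{xy}| ≤ [□x = i][□y = l]·|Δ_{xy}|`. [cite: BalabanImbrieJaffe1988, §5.13 p.305] -/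
theorem abs_pairMat_le (Δ : Matrix α α ℝ) (i l : I) (x y : α) :
    |pairMat blk Δ i l x y| ≤ (if blk x = i then 1 else 0) * ((if blk y = l then 1 else 0) * |Δ x y|) := by
  unfold pairMat
  split_ifs <;> simp

omit [Fintype α] [DecidableEq α] [Fintype I] in
/-- summed over any cube ranges, the vertex matrices at a site pair cost at most `|Δ_{xy}|`. [cite: BalabanImbrieJaffe1988, §5.13 p.305] -/
theorem sum_sum_abs_pairMat_le (Δ : Matrix α α ℝ) (B : Finset I) (T : I → Finset I) (x y : α) :
    ∑ i ∈ B, ∑ l ∈ T i, |pairMat blk Δ i l x y| ≤ |Δ x y| := by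
  have h1 : ∀ i ∈ B, ∑ l ∈ T i, |pairMat blk Δ i l x y| ≤ (if blk x = i then 1 else 0) * |Δ x y| := by
    intro i _
    refine (sum_le_sum fun l _ => abs_pairMat_le blk Δ i l x y).trans ?_
    rw [← mul_sum]
    refine mul_le_mul_of_nonneg_left ?_ (by positivity)
    rw [← sum_mul, sum_ite_eq (T i) (blk y) (fun _ => (1 : ℝ))]
    split_ifs
    · rw [one_mul]
    · rw [zero_mul]; exact abs_nonneg _
  refine (sum_le_sum h1).trans ?_
  rw [← sum_mul, sum_ite_eq B (blk x) (fun _ => (1 : ℝ))]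
  split_ifs
  · rw [one_mul]
  · rw [zero_mul]; exact abs_nonneg _

omit [Fintype α] [DecidableEq α] in
/-- **the vertex matrices are entrywise dominated by `Δ`**: `|M_B(s)_{xy}| ≤ |Δ_{xy}|` for `s ∈ [0,1]^I`. [cite: BalabanImbrieJaffe1988, §5.13 p.305] -/
theorem abs_bmat_apply_le (Δ : Matrix α α ℝ) {s : I → ℝ} (hs : ∀ l, 0 ≤ s l ∧ s l ≤ 1) (B : Finset I) (x y : α) :
    |bmat blk Δ s B x y| ≤ |Δ x y| := by
  unfold bmat
  split_ifs
  · rw [Matrix.sum_apply]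
    refine (abs_sum_le_sum_abs _ _).trans (le_trans (sum_le_sum fun i _ => ?_) (sum_sum_abs_pairMat_le blk Δ B (fun i => univ.erase i) x y))
    rw [Matrix.sum_apply]
    refine (abs_sum_le_sum_abs _ _).trans (sum_le_sum fun l _ => ?_)
    rw [Matrix.smul_apply, smul_eq_mul, abs_mul]
    exact mul_le_of_le_one_left (abs_nonneg _) (by rw [abs_of_nonneg (hs l).1]; exact (hs l).2)
  · rw [Matrix.sum_apply]
    refine (abs_sum_le_sum_abs _ _).trans (le_trans (sum_le_sum fun i _ => ?_) (sum_sum_abs_pairMat_le blk Δ B (fun i => B.erase i) x y))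
    rw [Matrix.sum_apply]
    refine (abs_sum_le_sum_abs _ _).trans (sum_le_sum fun l _ => ?_)
    rw [Matrix.smul_apply, smul_eq_mul, abs_mul]
    exact mul_le_of_le_one_left (abs_nonneg _) (by rw [abs_of_nonneg (by norm_num : (0 : ℝ) ≤ 1 / 2)]; norm_num)

omit [DecidableEq α] in
/-- **row sums of the boundary matrices `N_b = M_b(s) + M_b(s)ᵀ`**: `Σ_{x′} |N_b(x,x′)| ≤ 2·n·h` when `|Δ_{xy}| ≤ h` (`n` sites).
[cite: BalabanImbrieJaffe1988, §5.13 p.306] -/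
theorem sum_abs_bmat_add_transpose_le (Δ : Matrix α α ℝ) {s : I → ℝ} (hs : ∀ l, 0 ≤ s l ∧ s l ≤ 1) {h : ℝ} (hh : ∀ x y, |Δ x y| ≤ h)
    (B : Finset I) (x : α) : ∑ x', |(bmat blk Δ s B + (bmat blk Δ s B)ᵀ) x x'| ≤ 2 * (Fintype.card α * h) := by
  calc ∑ x', |(bmat blk Δ s B + (bmat blk Δ s B)ᵀ) x x'| ≤ ∑ _x' : α, 2 * h := sum_le_sum fun x' _ => by
        rw [Matrix.add_apply, Matrix.transpose_apply]
        refine (abs_add_le _ _).trans ?_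
        have h1 := (abs_bmat_apply_le blk Δ hs B x x').trans (hh x x')
        have h2 := (abs_bmat_apply_le blk Δ hs B x' x).trans (hh x' x)
        linarith
    _ = 2 * (Fintype.card α * h) := by rw [sum_const, card_univ, nsmul_eq_mul]; ring

/-! ## §2  The walk kernels of the restricted interpolated precisions -/

variable (Δ : Matrix α α ℝ)

/-- **the entries of the restricted interpolated inverse**: `|((Δ_{1_Λ})_s↾X″)⁻¹(x,l)| ≤ 2/m` (Combes–Thomas at rate `0`: only `Δ ≥ m·1` and a
bound on the entries are used). [cite: BalabanImbrieJaffe1988, §5.13 p.305] -/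
theorem abs_prec_inv_apply_le (hΔ : Δ.PosDef) {m : ℝ} (hm : 0 < m) (hΔm : ∀ φ : α → ℝ, m * (φ ⬝ᵥ φ) ≤ φ ⬝ᵥ (Δ *ᵥ φ)) {h : ℝ} (hh0 : 0 ≤ h)
    (hh : ∀ x y, |Δ x y| ≤ h) (Λc X'' : Finset I) {s : I → ℝ} (hs : ∀ i, 0 ≤ s i ∧ s i ≤ 1)
    (x l : BIJ88PolymerRep5134Gauss.Site blk X'') : |(prec blk (interpForm blk Δ (corner ℝ Λc)) X'' s)⁻¹ x l| ≤ 2 / m := by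
  have h1 := restricted_inv_decay (blk := blk) (Δ := Δ) (fun _ _ => (0 : ℝ)) (fun _ => rfl) (fun _ _ => rfl)
    (fun _ _ _ => by norm_num) (fun _ _ h01 => absurd h01 (by norm_num)) hh0 (fun x y _ => hh x y) (z := Fintype.card α)
    (fun x => by exact_mod_cast card_le_univ _) hΔ hm hΔm le_rfl (by rw [Real.exp_zero, sub_self, mul_zero]; positivity) Λc hs
    (fun x => blk x ∈ X'') x l
  rw [zero_mul, neg_zero, Real.exp_zero, mul_one] at h1
  simpa [blkIn, prec] using h1

/-- **THE WALK-KERNEL CERTIFICATE FROM `Δ`-LETTERS** (sizes, no decay): for every `s ∈ [0,1]^I`, every vertex structure `c` and all sites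
`x, y` of `X″`, `|(C_s𝔫_s(c))(x,y)| ≤ (2/m)·((2/m)·n·(2nh)·2^{|I|})^{|c|}`, `n = |sites of X″|`. [cite: BalabanImbrieJaffe1988, §5.13 (5.13.3) p.306,
p.307 L14–16] -/
theorem abs_prec_inv_mul_wker_apply_le (hΔ : Δ.PosDef) {m : ℝ} (hm : 0 < m) (hΔm : ∀ φ : α → ℝ, m * (φ ⬝ᵥ φ) ≤ φ ⬝ᵥ (Δ *ᵥ φ)) {h : ℝ}
    (hh0 : 0 ≤ h) (hh : ∀ x y, |Δ x y| ≤ h) (Λc X'' : Finset I) {s : I → ℝ} (hs : ∀ i, 0 ≤ s i ∧ s i ≤ 1) (cg : Finset (Finset I))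
    (x y : BIJ88PolymerRep5134Gauss.Site blk X'') :
    |((prec blk (interpForm blk Δ (corner ℝ Λc)) X'' s)⁻¹ *
        wker (prec blk (interpForm blk Δ (corner ℝ Λc)) X'' s)⁻¹
          (fun b => bmat (fun x : BIJ88PolymerRep5134Gauss.Site blk X'' => blk x.1)
              ((interpForm blk Δ (corner ℝ Λc)).submatrix Subtype.val Subtype.val) s b
            + (bmat (fun x : BIJ88PolymerRep5134Gauss.Site blk X'' => blk x.1)
              ((interpForm blk Δ (corner ℝ Λc)).submatrix Subtype.val Subtype.val) s b)ᵀ) cg) x y| ≤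
      2 / m * (2 / m * Fintype.card (BIJ88PolymerRep5134Gauss.Site blk X'') *
        (2 * (Fintype.card (BIJ88PolymerRep5134Gauss.Site blk X'') * h)) * 2 ^ Fintype.card I) ^ cg.card := by
  have hC : ∀ y' x' : BIJ88PolymerRep5134Gauss.Site blk X'',
      |(prec blk (interpForm blk Δ (corner ℝ Λc)) X'' s)⁻¹ y' x'| ≤ 2 / m * Real.exp (-((0 : ℝ) * (0 : ℝ))) := fun y' x' => by
    rw [zero_mul, neg_zero, Real.exp_zero, mul_one]; exact abs_prec_inv_apply_le blk Δ hΔ hm hΔm hh0 hh Λc X'' hs y' x'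
  -- the restricted corner form is entrywise dominated by `Δ`
  have hent : ∀ x' y' : BIJ88PolymerRep5134Gauss.Site blk X'',
      |((interpForm blk Δ (corner ℝ Λc)).submatrix Subtype.val Subtype.val : Matrix _ _ ℝ) x' y'| ≤ h := fun x' y' => by
    rw [Matrix.submatrix_apply]
    exact (BIJ88EndChainFluct309.abs_interpForm_apply_le (blk := blk) (Δ := Δ) (corner_mem_cube Λc) _ _).trans (hh _ _)
  rcases cg.eq_empty_or_nonempty with rfl | hcg
  · rw [wker_empty, Matrix.mul_one, card_empty, pow_zero, mul_one]
    exact abs_prec_inv_apply_le blk Δ hΔ hm hΔm hh0 hh Λc X'' hs x y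
  have hK : ∀ c : Finset (Finset I), ∑ _b' ∈ c, (1 : ℝ) ≤ 2 ^ Fintype.card I := fun c => by
    rw [sum_const, nsmul_eq_mul, mul_one]
    have : c.card ≤ 2 ^ Fintype.card I := (card_le_univ c).trans (by rw [Fintype.card_finset])
    exact_mod_cast this
  have h := abs_C_mul_wker_apply_le_geometric_entry (I := I) (ρ := fun _ _ => (0 : ℝ)) (δ := 0) (U := fun _ => Set.univ)
    (U' := fun _ => Set.univ) (fun _ _ => le_rfl) le_rfl hC
    (Z := Fintype.card (BIJ88PolymerRep5134Gauss.Site blk X''))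
    (fun y' => by rw [zero_div]; simp)
    (N := fun b => bmat (fun x : BIJ88PolymerRep5134Gauss.Site blk X'' => blk x.1)
        ((interpForm blk Δ (corner ℝ Λc)).submatrix Subtype.val Subtype.val) s b
      + (bmat (fun x : BIJ88PolymerRep5134Gauss.Site blk X'' => blk x.1)
        ((interpForm blk Δ (corner ℝ Λc)).submatrix Subtype.val Subtype.val) s b)ᵀ)
    (fun b x x' _ => ⟨Set.mem_univ _, Set.mem_univ _⟩)
    (fun b x' => sum_abs_bmat_add_transpose_le (fun x : BIJ88PolymerRep5134Gauss.Site blk X'' => blk x.1) _ hs hent b x')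
    y (E := fun _ _ => 1) (Eout := fun _ => 1) (fun _ _ => zero_le_one)
    (fun b b' x' _ x'' _ => by rw [zero_div, zero_mul, neg_zero, Real.exp_zero])
    (fun b x' _ => by rw [zero_div, zero_mul, neg_zero, Real.exp_zero]) (fun _ => le_rfl) (fun b c => hK c)
    x (Ein := fun _ => 1) (fun _ => zero_le_one) (fun b' x' _ => by rw [zero_div, zero_mul, neg_zero, Real.exp_zero]) hcg (hK cg)
  exact h

end Literature.MathematicalPhysics.QuantumFieldTheory.BalabanImbrieJaffe1984to88.BIJ88WalkKernelCrude309
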